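import Summits.ResolutionOfSingularities.ResolutionOfSingularities.Theorems.WeightedInvariantTieNoDropSuccessor
import Summits.ResolutionOfSingularities.ResolutionOfSingularities.Theorems.WeightedInvariantContactCylinderCompatibility
import Summits.ResolutionOfSingularities.ResolutionOfSingularities.Theorems.WeightedInvariantIota3FlagTools
import HarnessLib

/-!
# Two tie presentations — or a tie presentation and a second lex-maximal datum — have the SAME weights and span the SAME
# weighted filtration on the threefold ring (door `HypersurfaceCentreConstruction`, stmt-ResolutionOfSingularities-19897, route
# `WeightedInvariant`, P3 rung `KeyRungGrLE 3 p`, clause (c8)≤3,p for `τ`: the presentation transfer of the in-chart step)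

[OURS · L1 W4.3 · cell `res-hironaka`, HUMAN RULING D-0089] Helper file `--supports stmt-ResolutionOfSingularities-19897` (line
`local-engine` of res-L1-w43-plan-1, RULING gen 11 #5 / gen 12 #10 variant (V-AQS), spec `L/res-type-047/D2-INCHART-SPEC.md`
§2 (S5)).  In the Chevalley argument for the finiteness of the tie points the GLOBAL move along the curve `V(P)` is built on ONE
lex-maximal datum `(y′, x′; r, q)`, while a tie point `z′` of the curve comes with ITS OWN tie presentation
`(x₁, y₁, z₁; q₁, r₁; λ₁)` (`Iota3.IsTiePresentation`, res-type-092).  This file identifies the two on the threefold ring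
`S = 𝒪_{z′}`: the weights agree and the weighted filtrations `𝒥ₙ((y₁, x₁); (r, q)) = 𝒥ₙ((y′, x′); (r, q))` agree FOR EVERY `n` as
ideals of `S` — so res-D-brk-1's localisation dictionary (`ContactCylinder.exists_ringHom_ringEquiv_of_prime_localMove'`, whose
local move is `extReesAlgebra I'` for ANY presentation `I'` of the localised pieces) is fed with `I' :=` the tie presentation's own
filtration, on which `Iota3.IsTiePresentation.exists_successor_le_adicOrder` (`…TieNoDropSuccessor`) produces the no-drop successor.

Mechanism: Abramovich–Quek–Schober uniqueness at the TWO-dimensional ring `S_P` (`LexMaxCentre.eq_of_isLexMaxWeightedCentreGerm`,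
res-type-092: equal weights, level, and filtration on `S_P`), then CONTRACTION to `S`: the pieces `𝒥ₙ((y, x); w)` of a pair with
independent differentials inside `P` are contracted from `S_P` (res-type-005's `ContactCylinder.comap_map_weightedMonomialIdeal_eq_of_linearIndependent`,
p521270 — they are primary to `(y, x)`).

* `TieFinite.weightedMonomialIdeal_eq_of_isLexMax_localization` — the general statement for two pairs `u₁, u₂ : Fin 2 → S`;
* `Iota3.IsTiePresentation.weightedMonomialIdeal_eq_of_isLexMax` / `….weights_eq_of_isLexMax` — read off a tie presentation and a
  second lex-maximal datum `(u; w; ℓ)` at `S_{P₀}`: `w = (r₁, q₁)`, `ℓ = r₁ ν`, and `𝒥ₙ(u; w) = 𝒥ₙ((y₁, x₁); (r₁, q₁))` for all `n`.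

[OURS] Replaces the role of NO printed item; NOT a statement of the manuscript under review [claim: Hironaka2017, status:
under-review].  AI work, weaker than expert review.  Def-free.

## References

* D. Abramovich, M. H. Quek, B. Schober, *Torus actions, weighted blow-ups, and desingularization of plane curves*,
  arXiv:2507.01232 (v3, 2026), Thm 3.5 («well-defined, unique»; proof (c)). [AbramovichQuekSchober2025]
* H. Matsumura, *Commutative Ring Theory*, Thm. 14.2, §6 (primary decomposition and localisation). [Matsumura1987]
-/

noncomputable section

set_option linter.dupNamespace false -- mandated namespace `Summit.<Summit>.<Problem>` of this single-conjunct summit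

open IsLocalRing Literature.AlgebraicGeometry.Resolution
open Summit.ResolutionOfSingularities.ResolutionOfSingularities.Theorems

namespace Summit.ResolutionOfSingularities.ResolutionOfSingularities.Cruxes.HypersurfaceCentreConstruction.LocalEngine

namespace TieFinite

variable {S : Type} [CommRing S] [IsRegularLocalRing S]

/-- **Two lex-maximal data presented on `S` agree on `S`.**  `S` regular local, `P` a prime, `u₁, u₂ : Fin 2 → S` pairs inside `P`
with linearly independent differentials; if `(u₁/1; w₁; ℓ₁)` and `(u₂/1; w₂; ℓ₂)` are both lex-maximal admissible weighted centre
germs of the same ideal `I ⊆ S_P`, then `w₁ = w₂`, `ℓ₁ = ℓ₂`, and `𝒥ₙ(u₁; w₁) = 𝒥ₙ(u₂; w₁)` as ideals of `S` for every `n`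
(AQS uniqueness on `S_P`, then contraction of the `(uᵢ)`-primary pieces). [cite: AbramovichQuekSchober2025, Thm 3.5] -/
theorem weightedMonomialIdeal_eq_of_isLexMax_localization (P : Ideal S) [P.IsPrime] {I : Ideal (Localization.AtPrime P)}
    {u₁ u₂ : Fin 2 → S} (hu₁ : ∀ i, u₁ i ∈ maximalIdeal S) (hu₂ : ∀ i, u₂ i ∈ maximalIdeal S)
    (hli₁ : LinearIndependent (ResidueField S) fun i => (maximalIdeal S).toCotangent ⟨u₁ i, hu₁ i⟩)
    (hli₂ : LinearIndependent (ResidueField S) fun i => (maximalIdeal S).toCotangent ⟨u₂ i, hu₂ i⟩)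
    (hu₁P : ∀ i, u₁ i ∈ P) (hu₂P : ∀ i, u₂ i ∈ P) {w₁ w₂ : Fin 2 → ℕ} {ℓ₁ ℓ₂ : ℕ}
    (h₁ : IsLexMaxWeightedCentreGerm (Localization.AtPrime P) I (fun i => algebraMap S (Localization.AtPrime P) (u₁ i)) w₁ ℓ₁)
    (h₂ : IsLexMaxWeightedCentreGerm (Localization.AtPrime P) I (fun i => algebraMap S (Localization.AtPrime P) (u₂ i)) w₂ ℓ₂) :
    w₁ = w₂ ∧ ℓ₁ = ℓ₂ ∧ ∀ n, weightedMonomialIdeal u₁ w₁ n = weightedMonomialIdeal u₂ w₁ n := by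
  obtain ⟨hw, hℓ, heq⟩ := LexMaxCentre.eq_of_isLexMaxWeightedCentreGerm h₁ h₂
  refine ⟨hw, hℓ, fun n => ?_⟩
  rcases Nat.eq_zero_or_pos n with rfl | hn
  · rw [weightedMonomialIdeal_zero, weightedMonomialIdeal_zero]
  have hpos : ∀ i, 0 < w₁ i := h₁.2.1
  rw [← ContactCylinder.comap_map_weightedMonomialIdeal_eq_of_linearIndependent P u₁ hu₁ hli₁ hu₁P w₁ hpos hn,
    ← ContactCylinder.comap_map_weightedMonomialIdeal_eq_of_linearIndependent P u₂ hu₂ hli₂ hu₂P w₁ hpos hn,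
    weightedMonomialIdeal_map, weightedMonomialIdeal_map, heq n]

end TieFinite

namespace Iota3

variable {S : Type} [CommRing S] [IsRegularLocalRing S]

/-- The regular system `(y, x, z)` of a tie presentation, in the `Set.range` letters of res-type-092's toolkit. [OURS] -/
theorem IsTiePresentation.span_range_eq {f x y z : S} {q r : ℕ} {lam : S} (h : IsTiePresentation S f x y z q r lam) :
    Ideal.span (Set.range ![y, x, z]) = maximalIdeal S := by
  rw [← h.1, Matrix.range_cons, Matrix.range_cons, Matrix.range_cons, Matrix.range_empty, Set.union_empty,
    Set.singleton_union, Set.singleton_union, Set.insert_comm y x]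

/-- The order `ν` hidden in a tie presentation is pinned by `f ∈ 𝔪^ν ∖ 𝔪^{ν+1}`. [folklore] -/
theorem eq_of_mem_pow_of_not_mem_pow {f : S} {ν ν' : ℕ} (hfν : f ∈ maximalIdeal S ^ ν) (hfν' : f ∉ maximalIdeal S ^ (ν + 1))
    (h₁ : f ∈ maximalIdeal S ^ ν') (h₂ : f ∉ maximalIdeal S ^ (ν' + 1)) : ν = ν' := by
  by_contra hne
  rcases Nat.lt_or_gt_of_ne hne with hlt | hgt
  · exact hfν' (Ideal.pow_le_pow_right (by omega) h₁)
  · exact h₂ (Ideal.pow_le_pow_right (by omega) hfν)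

/-- **A tie presentation and a second lex-maximal datum at `S_{P₀}` have the same weights and level, and span the same weighted
filtration on `S`.**  `S` regular local of dimension `3`; `Iota3.IsTiePresentation S f x₁ y₁ z₁ q₁ r₁ lam₁` with
`f ∈ 𝔪^ν ∖ 𝔪^{ν+1}`; `P` the generic prime of the top `(ν ; ε)`-stratum (`= (x₁, y₁)`); `u : Fin 2 → S` a pair inside `P` with
independent differentials such that `(u/1; w; ℓ)` is a lex-maximal admissible weighted centre germ of `(f/1) ⊆ S_P`.  Then
`w = (r₁, q₁)`, `ℓ = r₁ ν`, and `𝒥ₙ(u; w) = 𝒥ₙ((y₁, x₁); (r₁, q₁))` for every `n`. [cite: AbramovichQuekSchober2025, Thm 3.5] -/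
theorem IsTiePresentation.weightedMonomialIdeal_eq_of_isLexMax {f x₁ y₁ z₁ : S} {q₁ r₁ : ℕ} {lam₁ : S}
    (h : IsTiePresentation S f x₁ y₁ z₁ q₁ r₁ lam₁) (hdim : ringKrullDim S = 3) {ν : ℕ}
    (hfν : f ∈ maximalIdeal S ^ ν) (hfν' : f ∉ maximalIdeal S ^ (ν + 1))
    (P : Ideal S) [P.IsPrime] (hP : ContactCylinder.topStratumPrime iotaOrdEps S f = P)
    {u : Fin 2 → S} (hu : ∀ i, u i ∈ maximalIdeal S)
    (hli : LinearIndependent (ResidueField S) fun i => (maximalIdeal S).toCotangent ⟨u i, hu i⟩) (huP : ∀ i, u i ∈ P)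
    {w : Fin 2 → ℕ} {ℓ : ℕ}
    (hlex : IsLexMaxWeightedCentreGerm (Localization.AtPrime P)
      (Ideal.span {algebraMap S (Localization.AtPrime P) f}) (fun i => algebraMap S (Localization.AtPrime P) (u i)) w ℓ) :
    w = ![r₁, q₁] ∧ ℓ = r₁ * ν ∧ ∀ n, weightedMonomialIdeal u w n = weightedMonomialIdeal ![y₁, x₁] ![r₁, q₁] n := by
  have hyxz := h.span_range_eq
  have hd := spanFinrank_eq_three_of_ringKrullDim hdim
  obtain ⟨-, hP₁, ν', hP₁', hν'1, hν'2, hlex₁, -⟩ := h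
  obtain rfl : ν = ν' := eq_of_mem_pow_of_not_mem_pow hfν hfν' hν'1 hν'2
  have hPe : P = Ideal.span {x₁, y₁} := hP.symm.trans hP₁
  subst hPe
  -- the tie presentation's pair `(y₁, x₁)`
  have hu₁P : ∀ i, (![y₁, x₁] : Fin 2 → S) i ∈ Ideal.span ({x₁, y₁} : Set S) := by
    intro i; fin_cases i
    · exact Ideal.subset_span (Set.mem_insert_of_mem _ (Set.mem_singleton _))
    · exact Ideal.subset_span (Set.mem_insert _ _)
  have hvec : (fun i => algebraMap S (Localization.AtPrime (Ideal.span ({x₁, y₁} : Set S))) ((![y₁, x₁] : Fin 2 → S) i)) =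
      ![algebraMap S _ y₁, algebraMap S _ x₁] := by
    funext i; fin_cases i <;> rfl
  have hlex₁' : IsLexMaxWeightedCentreGerm (Localization.AtPrime (Ideal.span ({x₁, y₁} : Set S)))
      (Ideal.span {algebraMap S _ f}) (fun i => algebraMap S _ ((![y₁, x₁] : Fin 2 → S) i)) ![r₁, q₁] (r₁ * ν) := by
    rw [hvec]; exact hlex₁
  obtain ⟨hw, hℓ, heq⟩ := TieFinite.weightedMonomialIdeal_eq_of_isLexMax_localization (Ideal.span ({x₁, y₁} : Set S))
    hu (LocalGameEFTCylinder.mem_maximalIdeal_pair hyxz) hli (LocalGameEFTCylinder.linearIndependent_toCotangent_pair hyxz hd)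
    huP hu₁P hlex hlex₁'
  subst hw
  exact ⟨rfl, hℓ, heq⟩

/-- Weights and level only. [cite: AbramovichQuekSchober2025, Thm 3.5] -/
theorem IsTiePresentation.weights_eq_of_isLexMax {f x₁ y₁ z₁ : S} {q₁ r₁ : ℕ} {lam₁ : S}
    (h : IsTiePresentation S f x₁ y₁ z₁ q₁ r₁ lam₁) (hdim : ringKrullDim S = 3) {ν : ℕ}
    (hfν : f ∈ maximalIdeal S ^ ν) (hfν' : f ∉ maximalIdeal S ^ (ν + 1))
    (P : Ideal S) [P.IsPrime] (hP : ContactCylinder.topStratumPrime iotaOrdEps S f = P)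
    {u : Fin 2 → S} (hu : ∀ i, u i ∈ maximalIdeal S)
    (hli : LinearIndependent (ResidueField S) fun i => (maximalIdeal S).toCotangent ⟨u i, hu i⟩) (huP : ∀ i, u i ∈ P)
    {w : Fin 2 → ℕ} {ℓ : ℕ}
    (hlex : IsLexMaxWeightedCentreGerm (Localization.AtPrime P)
      (Ideal.span {algebraMap S (Localization.AtPrime P) f}) (fun i => algebraMap S (Localization.AtPrime P) (u i)) w ℓ) :
    w 0 = r₁ ∧ w 1 = q₁ ∧ ℓ = r₁ * ν := by
  obtain ⟨hw, hℓ, -⟩ := h.weightedMonomialIdeal_eq_of_isLexMax hdim hfν hfν' P hP hu hli huP hlex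
  subst hw
  exact ⟨rfl, rfl, hℓ⟩

end Iota3

end Summit.ResolutionOfSingularities.ResolutionOfSingularities.Cruxes.HypersurfaceCentreConstruction.LocalEngine

end
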